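import Summits.AtomisticToContinuum.HydrodynamicLimit.Theorems.CollisionIsometryCLTAdaptedWeightCLTBHEEPClosureBounds
import Summits.AtomisticToContinuum.HydrodynamicLimit.Theorems.CollisionIsometryCLTAdaptedWeightCLTBHEEPClosureEntropy

/-!
# Stub `stub_eepClosure` (S5) of the line `block-h-dissipation-closure`, helper file 7: FLUX INTEGRALS of the
regularised law — integrability and uniform bounds on `V3 × V3 × S²`
(crux `CollisionIsometryCLT.AdaptedWeightCLT`, stmt-AtomisticToContinuum-14868; `--supports`)

The pair-space half of the a-priori estimates of `stub_eepClosure`: for a continuous `f ≥ 0` on `ℝ³` whose sixth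
moment `Φ = f (1+|w|²)³` is integrable, the flux-weighted pair integrands of steps (i)–(ii) are dominated by the
product `Φ(v) Φ(v_*)` (the hard-sphere kernel is at most `|v − v_*| ≤ 2 (1+|v|²)(1+|v_*|²)`, and the co-moving
energy weight `W = 4A + (|v−u|² + |v_*−u|²)/h²` is at most `(4A + (4|u|²+2)/h²)(1+|v|²)(1+|v_*|²)`):
* `integrable_kernel_mul_pair_of_cube`, `integrable_kernel_mul_pair_weight_sq_of_cube` — `B f f_*` and `B f f_* W²`
  are integrable for `pairDirMeasure`;
* `fluxZ_le_of_cube`, `integral_kernel_weight_sq_le_of_cube` — `Z(f) ≤ 2 |S²| (∫Φ)²`,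
  `∫ B f f_* W² ≤ 2 (4A + (4|u|²+2)/h²)² |S²| (∫Φ)²`;
and, for the regularised law of a probability cloud with `Σ p_i (1 + |v_i|²)³ ≤ R` (helper file 6), the resulting
UNIFORM ENTROPY-PRODUCTION BOUND of step (i) (`exists_entropyProduction_cloudLaw_le`): there are
`Z₀, J₀` depending only on `(h, δ, R)` with `D(f̂) ≤ (3/2)(2 + L) Z₀ 𝒟h(f̂) + J₀/(2L)` for every `L > 0`.
No definitions. Registered anchor: `bhEEPClosure_flux_anchor` (the kernel bound `B ≤ 2(1+|v|²)(1+|v_*|²)`).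
-/

namespace Summit.AtomisticToContinuum.HydrodynamicLimit.Theorems.BlockHDissipation

open scoped BigOperators Topology Classical MeasureTheory ENNReal InnerProductSpace
open Filter Set MeasureTheory Real
open Literature.Analysis.FluidPDE
open Summit.AtomisticToContinuum.HydrodynamicLimit.Theorems.ContactSourceDuhamel (T3 V3 Cfg Vel Flow Flows)
open Literature.MathematicalPhysics.KineticTheory (collide hardSphereKernel sphereMeasure)

noncomputable section

namespace EEP

/-! ## Pointwise domination by the product of sixth moments -/

/-- `|v| + |v_*| ≤ 2 (1+|v|²)(1+|v_*|²)`. -/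
theorem norm_add_norm_le (v w : V3) : ‖v‖ + ‖w‖ ≤ 2 * ((1 + ‖v‖ ^ 2) * (1 + ‖w‖ ^ 2)) := by
  nlinarith [norm_nonneg v, norm_nonneg w, sq_nonneg (‖v‖ - 1), sq_nonneg (‖w‖ - 1),
    mul_nonneg (sq_nonneg ‖v‖) (sq_nonneg ‖w‖), sq_nonneg ‖v‖, sq_nonneg ‖w‖]

/-- **Kernel bound**: `B(v − v_*, ω) ≤ 2 (1+|v|²)(1+|v_*|²)`. -/
theorem hardSphereKernel_le_poly (pr : V3 × V3) (ω : Metric.sphere (0 : V3) 1) :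
    hardSphereKernel pr ω ≤ 2 * ((1 + ‖pr.1‖ ^ 2) * (1 + ‖pr.2‖ ^ 2)) :=
  (DVTransfer.hardSphereKernel_le_norm pr ω).trans ((norm_sub_le _ _).trans (norm_add_norm_le _ _))

/-- **Weight bound**: `4A + (|v−u|² + |v_*−u|²)/h² ≤ (4A + (4|u|²+2)/h²)(1+|v|²)(1+|v_*|²)` for `A ≥ 0`. -/
theorem weight_le_poly {A h : ℝ} (hA : 0 ≤ A) (hh : 0 < h) (u v w : V3) :
    4 * A + (‖v - u‖ ^ 2 + ‖w - u‖ ^ 2) / h ^ 2 ≤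
      (4 * A + (4 * ‖u‖ ^ 2 + 2) / h ^ 2) * ((1 + ‖v‖ ^ 2) * (1 + ‖w‖ ^ 2)) := by
  have hP : 1 ≤ (1 + ‖v‖ ^ 2) * (1 + ‖w‖ ^ 2) := by nlinarith [sq_nonneg ‖v‖, sq_nonneg ‖w‖, mul_nonneg (sq_nonneg ‖v‖) (sq_nonneg ‖w‖)]
  have hvu : ‖v - u‖ ^ 2 ≤ 2 * ‖v‖ ^ 2 + 2 * ‖u‖ ^ 2 := by
    nlinarith [norm_sub_le v u, norm_nonneg (v - u), norm_nonneg v, norm_nonneg u, sq_nonneg (‖v‖ - ‖u‖)]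
  have hwu : ‖w - u‖ ^ 2 ≤ 2 * ‖w‖ ^ 2 + 2 * ‖u‖ ^ 2 := by
    nlinarith [norm_sub_le w u, norm_nonneg (w - u), norm_nonneg w, norm_nonneg u, sq_nonneg (‖w‖ - ‖u‖)]
  have hnum : ‖v - u‖ ^ 2 + ‖w - u‖ ^ 2 ≤ (4 * ‖u‖ ^ 2 + 2) * ((1 + ‖v‖ ^ 2) * (1 + ‖w‖ ^ 2)) := by
    nlinarith [hvu, hwu, sq_nonneg ‖u‖, sq_nonneg ‖v‖, sq_nonneg ‖w‖, mul_nonneg (sq_nonneg ‖v‖) (sq_nonneg ‖w‖),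
      mul_nonneg (sq_nonneg ‖u‖) (mul_nonneg (sq_nonneg ‖v‖) (sq_nonneg ‖w‖)),
      mul_nonneg (sq_nonneg ‖u‖) (sq_nonneg ‖v‖), mul_nonneg (sq_nonneg ‖u‖) (sq_nonneg ‖w‖)]
  have h1 : (‖v - u‖ ^ 2 + ‖w - u‖ ^ 2) / h ^ 2 ≤ (4 * ‖u‖ ^ 2 + 2) / h ^ 2 * ((1 + ‖v‖ ^ 2) * (1 + ‖w‖ ^ 2)) := by
    rw [div_mul_eq_mul_div]; exact div_le_div_of_nonneg_right hnum (by positivity)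
  have h2 : 4 * A ≤ 4 * A * ((1 + ‖v‖ ^ 2) * (1 + ‖w‖ ^ 2)) := le_mul_of_one_le_right (by positivity) hP
  nlinarith [h1, h2]

section Generic

variable {f : V3 → ℝ} (hfc : Continuous f) (hf0 : ∀ w, 0 ≤ f w)
  (hΦ : Integrable fun w => f w * (1 + ‖w‖ ^ 2) ^ 3)

/-- The product of sixth moments is integrable on pair space, with integral `|S²| (∫Φ)²`. -/
theorem integrable_cube_prod (hΦ : Integrable fun w => f w * (1 + ‖w‖ ^ 2) ^ 3) :
    Integrable (fun q : PairDir => (f q.1.1 * (1 + ‖q.1.1‖ ^ 2) ^ 3) * (f q.1.2 * (1 + ‖q.1.2‖ ^ 2) ^ 3))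
      pairDirMeasure := by
  haveI := isFiniteMeasure_sphereMeasure (E := V3)
  exact (hΦ.mul_prod hΦ).comp_fst sphereMeasure

/-- `∫ Φ(v) Φ(v_*) dq = |S²| (∫ Φ)²`. -/
theorem integral_cube_prod (f : V3 → ℝ) :
    ∫ q : PairDir, (f q.1.1 * (1 + ‖q.1.1‖ ^ 2) ^ 3) * (f q.1.2 * (1 + ‖q.1.2‖ ^ 2) ^ 3) ∂pairDirMeasure =
      sphereMeasure.real (univ : Set (Metric.sphere (0 : V3) 1)) * (∫ w, f w * (1 + ‖w‖ ^ 2) ^ 3) ^ 2 := by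
  haveI := isFiniteMeasure_sphereMeasure (E := V3)
  rw [DVTransfer.pairDirMeasure_eq, integral_fun_fst (fun pr : V3 × V3 =>
    (f pr.1 * (1 + ‖pr.1‖ ^ 2) ^ 3) * (f pr.2 * (1 + ‖pr.2‖ ^ 2) ^ 3)),
    integral_prod_mul (μ := (volume : Measure V3)) (ν := (volume : Measure V3))
      (fun x : V3 => f x * (1 + ‖x‖ ^ 2) ^ 3) (fun x : V3 => f x * (1 + ‖x‖ ^ 2) ^ 3), smul_eq_mul, sq]

include hfc in
/-- Measurability of `B f f_* G` for a continuous weight `G`. -/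
theorem aestronglyMeasurable_kernel_mul_pair_mul {G : PairDir → ℝ} (hG : Continuous G) :
    AEStronglyMeasurable (fun q : PairDir => hardSphereKernel q.1 q.2 * (f q.1.1 * f q.1.2) * G q) pairDirMeasure := by
  refine Continuous.aestronglyMeasurable ?_
  have hB : Continuous fun q : PairDir => hardSphereKernel q.1 q.2 := DVTransfer.continuous_hardSphereKernel_pairDir
  exact (hB.mul ((hfc.comp (continuous_fst.comp continuous_fst)).mul (hfc.comp (continuous_snd.comp continuous_fst)))).mul hG

include hfc hf0 in
/-- **`B f f_*` is integrable** on pair space. -/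
theorem integrable_kernel_mul_pair_of_cube (hΦ : Integrable fun w => f w * (1 + ‖w‖ ^ 2) ^ 3) :
    Integrable (fun q : PairDir => hardSphereKernel q.1 q.2 * (f q.1.1 * f q.1.2)) pairDirMeasure := by
  have hm : AEStronglyMeasurable (fun q : PairDir => hardSphereKernel q.1 q.2 * (f q.1.1 * f q.1.2)) pairDirMeasure := by
    have := aestronglyMeasurable_kernel_mul_pair_mul hfc (G := fun _ => (1 : ℝ)) continuous_const
    simpa only [mul_one] using this
  refine ((integrable_cube_prod hΦ).const_mul 2).mono' hm (Eventually.of_forall fun q => ?_)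
  have hB0 : 0 ≤ hardSphereKernel q.1 q.2 := le_max_right _ _
  have hff : 0 ≤ f q.1.1 * f q.1.2 := mul_nonneg (hf0 _) (hf0 _)
  rw [Real.norm_eq_abs, abs_of_nonneg (mul_nonneg hB0 hff)]
  have hP1 : 1 ≤ (1 + ‖q.1.1‖ ^ 2) * (1 + ‖q.1.2‖ ^ 2) := by
    nlinarith [sq_nonneg ‖q.1.1‖, sq_nonneg ‖q.1.2‖, mul_nonneg (sq_nonneg ‖q.1.1‖) (sq_nonneg ‖q.1.2‖)]
  have hP3 : (1 + ‖q.1.1‖ ^ 2) * (1 + ‖q.1.2‖ ^ 2) ≤ ((1 + ‖q.1.1‖ ^ 2) * (1 + ‖q.1.2‖ ^ 2)) ^ 3 := by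
    calc (1 + ‖q.1.1‖ ^ 2) * (1 + ‖q.1.2‖ ^ 2) = ((1 + ‖q.1.1‖ ^ 2) * (1 + ‖q.1.2‖ ^ 2)) ^ 1 := (pow_one _).symm
      _ ≤ _ := pow_le_pow_right₀ hP1 (by norm_num)
  calc hardSphereKernel q.1 q.2 * (f q.1.1 * f q.1.2)
      ≤ 2 * ((1 + ‖q.1.1‖ ^ 2) * (1 + ‖q.1.2‖ ^ 2)) * (f q.1.1 * f q.1.2) :=
        mul_le_mul_of_nonneg_right (hardSphereKernel_le_poly q.1 q.2) hff
    _ ≤ 2 * ((1 + ‖q.1.1‖ ^ 2) * (1 + ‖q.1.2‖ ^ 2)) ^ 3 * (f q.1.1 * f q.1.2) := by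
        refine mul_le_mul_of_nonneg_right (mul_le_mul_of_nonneg_left hP3 (by norm_num)) hff
    _ = 2 * (f q.1.1 * (1 + ‖q.1.1‖ ^ 2) ^ 3 * (f q.1.2 * (1 + ‖q.1.2‖ ^ 2) ^ 3)) := by ring

include hfc hf0 in
/-- **`B f f_* W²` is integrable** on pair space (`A ≥ 0`, `h > 0`). -/
theorem integrable_kernel_mul_pair_weight_sq_of_cube (hΦ : Integrable fun w => f w * (1 + ‖w‖ ^ 2) ^ 3)
    {A h : ℝ} (hA : 0 ≤ A) (hh : 0 < h) (u : V3) :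
    Integrable (fun q : PairDir => hardSphereKernel q.1 q.2 * (f q.1.1 * f q.1.2) *
      (4 * A + (‖q.1.1 - u‖ ^ 2 + ‖q.1.2 - u‖ ^ 2) / h ^ 2) ^ 2) pairDirMeasure := by
  set Cw : ℝ := 4 * A + (4 * ‖u‖ ^ 2 + 2) / h ^ 2 with hCw
  have hCw0 : 0 ≤ Cw := by positivity
  have hm := aestronglyMeasurable_kernel_mul_pair_mul hfc
    (G := fun q : PairDir => (4 * A + (‖q.1.1 - u‖ ^ 2 + ‖q.1.2 - u‖ ^ 2) / h ^ 2) ^ 2) (by fun_prop)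
  refine ((integrable_cube_prod hΦ).const_mul (2 * Cw ^ 2)).mono' hm (Eventually.of_forall fun q => ?_)
  have hB0 : 0 ≤ hardSphereKernel q.1 q.2 := le_max_right _ _
  have hff : 0 ≤ f q.1.1 * f q.1.2 := mul_nonneg (hf0 _) (hf0 _)
  have hW0 : 0 ≤ 4 * A + (‖q.1.1 - u‖ ^ 2 + ‖q.1.2 - u‖ ^ 2) / h ^ 2 := by positivity
  rw [Real.norm_eq_abs, abs_of_nonneg (mul_nonneg (mul_nonneg hB0 hff) (sq_nonneg _))]
  set P : ℝ := (1 + ‖q.1.1‖ ^ 2) * (1 + ‖q.1.2‖ ^ 2) with hP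
  have hP0 : 0 ≤ P := by positivity
  have hW : 4 * A + (‖q.1.1 - u‖ ^ 2 + ‖q.1.2 - u‖ ^ 2) / h ^ 2 ≤ Cw * P := weight_le_poly hA hh u q.1.1 q.1.2
  have hWsq : (4 * A + (‖q.1.1 - u‖ ^ 2 + ‖q.1.2 - u‖ ^ 2) / h ^ 2) ^ 2 ≤ (Cw * P) ^ 2 := pow_le_pow_left₀ hW0 hW 2
  have hB : hardSphereKernel q.1 q.2 ≤ 2 * P := hardSphereKernel_le_poly q.1 q.2
  calc hardSphereKernel q.1 q.2 * (f q.1.1 * f q.1.2) * (4 * A + (‖q.1.1 - u‖ ^ 2 + ‖q.1.2 - u‖ ^ 2) / h ^ 2) ^ 2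
      ≤ (2 * P) * (f q.1.1 * f q.1.2) * (Cw * P) ^ 2 :=
        mul_le_mul (mul_le_mul_of_nonneg_right hB hff) hWsq (sq_nonneg _) (by positivity)
    _ = 2 * Cw ^ 2 * (f q.1.1 * (1 + ‖q.1.1‖ ^ 2) ^ 3 * (f q.1.2 * (1 + ‖q.1.2‖ ^ 2) ^ 3)) := by rw [hP]; ring

include hfc hf0 in
/-- **Flux bound**: `Z(f) ≤ 2 |S²| (∫ Φ)²`. -/
theorem fluxZ_le_of_cube (hΦ : Integrable fun w => f w * (1 + ‖w‖ ^ 2) ^ 3) :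
    fluxZ f ≤ 2 * (sphereMeasure.real (univ : Set (Metric.sphere (0 : V3) 1)) * (∫ w, f w * (1 + ‖w‖ ^ 2) ^ 3) ^ 2) := by
  rw [fluxZ, ← integral_cube_prod f, ← integral_const_mul]
  refine integral_mono (integrable_kernel_mul_pair_of_cube hfc hf0 hΦ) ((integrable_cube_prod hΦ).const_mul 2)
    fun q => ?_
  have hff : 0 ≤ f q.1.1 * f q.1.2 := mul_nonneg (hf0 _) (hf0 _)
  have hP1 : 1 ≤ (1 + ‖q.1.1‖ ^ 2) * (1 + ‖q.1.2‖ ^ 2) := by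
    nlinarith [sq_nonneg ‖q.1.1‖, sq_nonneg ‖q.1.2‖, mul_nonneg (sq_nonneg ‖q.1.1‖) (sq_nonneg ‖q.1.2‖)]
  have hP3 : (1 + ‖q.1.1‖ ^ 2) * (1 + ‖q.1.2‖ ^ 2) ≤ ((1 + ‖q.1.1‖ ^ 2) * (1 + ‖q.1.2‖ ^ 2)) ^ 3 := by
    calc (1 + ‖q.1.1‖ ^ 2) * (1 + ‖q.1.2‖ ^ 2) = ((1 + ‖q.1.1‖ ^ 2) * (1 + ‖q.1.2‖ ^ 2)) ^ 1 := (pow_one _).symm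
      _ ≤ _ := pow_le_pow_right₀ hP1 (by norm_num)
  calc hardSphereKernel q.1 q.2 * (f q.1.1 * f q.1.2)
      ≤ 2 * ((1 + ‖q.1.1‖ ^ 2) * (1 + ‖q.1.2‖ ^ 2)) * (f q.1.1 * f q.1.2) :=
        mul_le_mul_of_nonneg_right (hardSphereKernel_le_poly q.1 q.2) hff
    _ ≤ 2 * ((1 + ‖q.1.1‖ ^ 2) * (1 + ‖q.1.2‖ ^ 2)) ^ 3 * (f q.1.1 * f q.1.2) :=
        mul_le_mul_of_nonneg_right (mul_le_mul_of_nonneg_left hP3 (by norm_num)) hff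
    _ = 2 * (f q.1.1 * (1 + ‖q.1.1‖ ^ 2) ^ 3 * (f q.1.2 * (1 + ‖q.1.2‖ ^ 2) ^ 3)) := by ring

include hfc hf0 in
/-- **Tail-weight bound**: `∫ B f f_* W² ≤ 2 (4A + (4|u|²+2)/h²)² |S²| (∫ Φ)²`. -/
theorem integral_kernel_weight_sq_le_of_cube (hΦ : Integrable fun w => f w * (1 + ‖w‖ ^ 2) ^ 3)
    {A h : ℝ} (hA : 0 ≤ A) (hh : 0 < h) (u : V3) :
    ∫ q : PairDir, hardSphereKernel q.1 q.2 * (f q.1.1 * f q.1.2) *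
        (4 * A + (‖q.1.1 - u‖ ^ 2 + ‖q.1.2 - u‖ ^ 2) / h ^ 2) ^ 2 ∂pairDirMeasure ≤
      2 * (4 * A + (4 * ‖u‖ ^ 2 + 2) / h ^ 2) ^ 2 *
        (sphereMeasure.real (univ : Set (Metric.sphere (0 : V3) 1)) * (∫ w, f w * (1 + ‖w‖ ^ 2) ^ 3) ^ 2) := by
  set Cw : ℝ := 4 * A + (4 * ‖u‖ ^ 2 + 2) / h ^ 2 with hCw
  rw [← integral_cube_prod f, ← integral_const_mul]
  refine integral_mono (integrable_kernel_mul_pair_weight_sq_of_cube hfc hf0 hΦ hA hh u)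
    ((integrable_cube_prod hΦ).const_mul _) fun q => ?_
  have hB0 : 0 ≤ hardSphereKernel q.1 q.2 := le_max_right _ _
  have hff : 0 ≤ f q.1.1 * f q.1.2 := mul_nonneg (hf0 _) (hf0 _)
  have hW0 : 0 ≤ 4 * A + (‖q.1.1 - u‖ ^ 2 + ‖q.1.2 - u‖ ^ 2) / h ^ 2 := by positivity
  set P : ℝ := (1 + ‖q.1.1‖ ^ 2) * (1 + ‖q.1.2‖ ^ 2) with hP
  have hP0 : 0 ≤ P := by positivity
  have hW : 4 * A + (‖q.1.1 - u‖ ^ 2 + ‖q.1.2 - u‖ ^ 2) / h ^ 2 ≤ Cw * P := weight_le_poly hA hh u q.1.1 q.1.2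
  have hWsq : (4 * A + (‖q.1.1 - u‖ ^ 2 + ‖q.1.2 - u‖ ^ 2) / h ^ 2) ^ 2 ≤ (Cw * P) ^ 2 := pow_le_pow_left₀ hW0 hW 2
  have hB : hardSphereKernel q.1 q.2 ≤ 2 * P := hardSphereKernel_le_poly q.1 q.2
  calc hardSphereKernel q.1 q.2 * (f q.1.1 * f q.1.2) * (4 * A + (‖q.1.1 - u‖ ^ 2 + ‖q.1.2 - u‖ ^ 2) / h ^ 2) ^ 2
      ≤ (2 * P) * (f q.1.1 * f q.1.2) * (Cw * P) ^ 2 :=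
        mul_le_mul (mul_le_mul_of_nonneg_right hB hff) hWsq (sq_nonneg _) (by positivity)
    _ = 2 * Cw ^ 2 * (f q.1.1 * (1 + ‖q.1.1‖ ^ 2) ^ 3 * (f q.1.2 * (1 + ‖q.1.2‖ ^ 2) ^ 3)) := by rw [hP]; ring

end Generic

/-! ## The uniform entropy-production bound for the regularised law of a cloud -/

/-- Integrability of the sixth moment of the regularised law. -/
theorem integrable_cloudLaw_mul_cube {n : ℕ} {p : Fin n → ℝ} {v : Fin n → V3} {h : ℝ}
    (hp : ∀ i, 0 ≤ p i) (hh : 0 < h) (δ : ℝ) :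
    Integrable fun w => cloudLaw h δ p v w * (1 + ‖w‖ ^ 2) ^ 3 :=
  integrable_cloudLaw_mul_of_le hp hh δ continuous_one_add_norm_sq_cube (C := 1) (k := 6) fun w => by
    rw [abs_of_nonneg (by positivity), one_mul]; exact one_add_norm_sq_cube_le w

/-- **UNIFORM ENTROPY-PRODUCTION BOUND (step (i) with all constants uniform in the cell).** For `0 < h ≤ 1`,
`0 < δ < 1` and `R` there are `Z₀, J₀ ≥ 0` such that for every probability cloud with `Σ p_i (1 + |v_i|²)³ ≤ R` and
every `L > 0`: `D(f̂) ≤ (3/2)(2 + L) Z₀ 𝒟h(f̂) + J₀/(2L)`. -/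
theorem exists_entropyProduction_cloudLaw_le {h δ : ℝ} (hh : 0 < h) (hh1 : h ≤ 1) (hδ : 0 < δ) (hδ1 : δ < 1) (R : ℝ) :
    ∃ Z₀ J₀ : ℝ, 0 ≤ Z₀ ∧ 0 ≤ J₀ ∧ ∀ (n : ℕ) (p : Fin n → ℝ) (v : Fin n → V3), (∀ i, 0 ≤ p i) → ∑ i, p i = 1 →
      ∑ i, p i * (1 + ‖v i‖ ^ 2) ^ 3 ≤ R → ∀ L : ℝ, 0 < L →
        fluxZ (cloudLaw h δ p v) ≤ Z₀ ∧
        entropyProduction hardSphereKernel (cloudLaw h δ p v) ≤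
          3 / 2 * (2 + L) * (Z₀ * hellDiss (cloudLaw h δ p v)) + J₀ / (2 * L) := by
  obtain ⟨A, hA0, hA⟩ := exists_abs_log_cloudLaw_le hh hh1 hδ hδ1 R
  obtain ⟨C, hC0, hC⟩ := exists_integral_cloudLaw_mul_cube_le R
  set S : ℝ := sphereMeasure.real (univ : Set (Metric.sphere (0 : V3) 1)) with hS
  have hS0 : 0 ≤ S := measureReal_nonneg
  refine ⟨2 * (S * C ^ 2), 2 * (4 * A + (4 * |R| + 2) / h ^ 2) ^ 2 * (S * C ^ 2), by positivity, by positivity,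
    fun n p v hp hp1 hR L hL => ?_⟩
  have hf0 : ∀ w, 0 ≤ cloudLaw h δ p v w := fun w => (cloudLaw_pos hp hh hδ hδ1.le w).le
  have hfpos : ∀ w, 0 < cloudLaw h δ p v w := fun w => cloudLaw_pos hp hh hδ hδ1.le w
  have hfc := continuous_cloudLaw h δ p v
  have hfm : Measurable (cloudLaw h δ p v) := hfc.measurable
  have hΦ := integrable_cloudLaw_mul_cube (v := v) hp hh δ
  have hΦle : ∫ w, cloudLaw h δ p v w * (1 + ‖w‖ ^ 2) ^ 3 ≤ C := (hC h δ hh hh1 hδ.le hδ1.le n p v hp hp1 hR).1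
  have hΦ0 : 0 ≤ ∫ w, cloudLaw h δ p v w * (1 + ‖w‖ ^ 2) ^ 3 := integral_nonneg fun w => by
    exact mul_nonneg (hf0 w) (by positivity)
  have hΦsq : (∫ w, cloudLaw h δ p v w * (1 + ‖w‖ ^ 2) ^ 3) ^ 2 ≤ C ^ 2 := pow_le_pow_left₀ hΦ0 hΦle 2
  have hlog : ∀ w, |log (cloudLaw h δ p v w)| ≤ A + ‖w - cloudMean p v‖ ^ 2 / (2 * h ^ 2) :=
    fun w => (hA n p v hp hp1 hR w).1
  have hint := integrable_kernel_mul_pair_of_cube hfc hf0 hΦ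
  have hintW := integrable_kernel_mul_pair_weight_sq_of_cube hfc hf0 hΦ hA0 hh (cloudMean p v)
  have hZ : fluxZ (cloudLaw h δ p v) ≤ 2 * (S * C ^ 2) :=
    (fluxZ_le_of_cube hfc hf0 hΦ).trans (by nlinarith [hS0])
  have hR1 : 1 ≤ R := one_le_of_moment hp hp1 hR
  have hu : ‖cloudMean p v‖ ^ 2 ≤ |R| := (norm_cloudMean_sq_le hp hp1 hR).trans (le_abs_self R)
  have hJ : ∫ q : PairDir, hardSphereKernel q.1 q.2 * (cloudLaw h δ p v q.1.1 * cloudLaw h δ p v q.1.2) *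
      (4 * A + (‖q.1.1 - cloudMean p v‖ ^ 2 + ‖q.1.2 - cloudMean p v‖ ^ 2) / h ^ 2) ^ 2 ∂pairDirMeasure ≤
      2 * (4 * A + (4 * |R| + 2) / h ^ 2) ^ 2 * (S * C ^ 2) := by
    refine (integral_kernel_weight_sq_le_of_cube hfc hf0 hΦ hA0 hh (cloudMean p v)).trans ?_
    have h1 : 4 * A + (4 * ‖cloudMean p v‖ ^ 2 + 2) / h ^ 2 ≤ 4 * A + (4 * |R| + 2) / h ^ 2 := by
      have : (4 * ‖cloudMean p v‖ ^ 2 + 2) / h ^ 2 ≤ (4 * |R| + 2) / h ^ 2 :=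
        div_le_div_of_nonneg_right (by linarith) (by positivity)
      linarith
    have h2 : (4 * A + (4 * ‖cloudMean p v‖ ^ 2 + 2) / h ^ 2) ^ 2 ≤ (4 * A + (4 * |R| + 2) / h ^ 2) ^ 2 :=
      pow_le_pow_left₀ (by positivity) h1 2
    have h3 : S * (∫ w, cloudLaw h δ p v w * (1 + ‖w‖ ^ 2) ^ 3) ^ 2 ≤ S * C ^ 2 := mul_le_mul_of_nonneg_left hΦsq hS0
    exact mul_le_mul (mul_le_mul_of_nonneg_left h2 (by norm_num)) h3 (by positivity) (by positivity)
  refine ⟨hZ, ?_⟩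
  have hmain := entropyProduction_le hfm hfpos hlog hint hintW hL
  have hD0 : 0 ≤ hellDiss (cloudLaw h δ p v) := DVTransfer.hellDiss_nonneg hf0
  have hZ0 : 0 ≤ fluxZ (cloudLaw h δ p v) := DVTransfer.fluxZ_nonneg hf0
  calc entropyProduction hardSphereKernel (cloudLaw h δ p v)
      ≤ 3 / 2 * (2 + L) * (fluxZ (cloudLaw h δ p v) * hellDiss (cloudLaw h δ p v)) +
          (∫ q : PairDir, hardSphereKernel q.1 q.2 * (cloudLaw h δ p v q.1.1 * cloudLaw h δ p v q.1.2) *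
            (4 * A + (‖q.1.1 - cloudMean p v‖ ^ 2 + ‖q.1.2 - cloudMean p v‖ ^ 2) / h ^ 2) ^ 2 ∂pairDirMeasure) /
            (2 * L) := hmain
    _ ≤ 3 / 2 * (2 + L) * (2 * (S * C ^ 2) * hellDiss (cloudLaw h δ p v)) +
          2 * (4 * A + (4 * |R| + 2) / h ^ 2) ^ 2 * (S * C ^ 2) / (2 * L) := by
        refine add_le_add (mul_le_mul_of_nonneg_left (mul_le_mul_of_nonneg_right hZ hD0) (by positivity))
          (div_le_div_of_nonneg_right hJ (by positivity))

end EEP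

/-- Registered anchor of this helper file: the hard-sphere kernel is dominated by the product weight,
`B(v − v_*, ω) ≤ 2 (1+|v|²)(1+|v_*|²)` (`EEP.hardSphereKernel_le_poly`). -/
theorem bhEEPClosure_flux_anchor : ∀ (pr : V3 × V3) (ω : Metric.sphere (0 : V3) 1), Literature.MathematicalPhysics.KineticTheory.hardSphereKernel pr ω ≤ 2 * ((1 + ‖pr.1‖ ^ 2) * (1 + ‖pr.2‖ ^ 2)) :=
  fun pr ω => EEP.hardSphereKernel_le_poly pr ω

end

end Summit.AtomisticToContinuum.HydrodynamicLimit.Theorems.BlockHDissipation
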